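import Literature.Geometry.Riemannian.ShrinkerMinimumPrincipleCalculus
import Literature.Geometry.Riemannian.GradientSolitonIdentities
import Literature.Geometry.Riemannian.RicciFlowScalarCurvatureComparison
import Literature.Geometry.Lorentzian.HessianLocalMax
import Literature.Geometry.Riemannian.ExpMapEnergyTaylor
import Literature.Geometry.Riemannian.MaximalGeodesicRescaling
import Literature.Geometry.Riemannian.HopfRinowHeineBorel
import Literature.Geometry.Riemannian.VolumeSphereTheoremJacobiFrameProofs
import Literature.Geometry.Riemannian.CutLocusProofs
import HarnessLib

/-!
# The localised minimum principle for `R ≥ 0` on a complete gradient shrinker (Zhang 2009,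
# proof of Thm. 1.3, Step 1) — part 2: the geometric argument

Towards the discharge of the named fact `shrinkerScalarCurvature_nonneg` (Z.-H. Zhang, Proc. AMS
137 (2009), Thm. 1.3 (ii): complete gradient shrinking Ricci solitons `Ric + Hess f = g/2` have
`R ≥ 0`; B.-L. Chen, JDG 82 (2009), Cor. 2.5). Zhang's Step 1 splits into (A) the weighted
Laplacian comparison for `d(p, ·)` along geodesic directions — an upper-barrier DATUM: at every `x₀`
with `d(p, x₀) ≥ 1` a `g`-orthonormal frame `e_o`, reals `q_o` with
`d(p, exp_{x₀}(s e_o)) ≤ d(p, x₀) + [o = none] s + q_o s²` for small `s` and `2 Σ q_o − df(e none) ≤ C(p)`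
(`ShrinkerDistanceComparison.lean`) — and (B), THIS FILE (`minimumPrinciple_core`): the datum
forces `R ≥ 0`. The one-variable calculus is part 1 (`ShrinkerMinimumPrincipleCalculus.lean`).

PROOF (Zhang's Step 1 with the distance replaced by the datum). Suppose `R(p) < 0`. With the
cut-off `ψ` of `exists_cutoffSq` and `A ≥ 2`, `u = ψ(d(p,·)/A) R` is continuous, vanishes off the
compact ball `B̄(p, A)` and `u(p) = R(p) < 0`, so it has a negative global minimum `x_m`, where
`ψ > 0`, `R < 0`, `d(p, x_m) < A`. If `d(p, x_m) < 1` then `u = R` near `x_m` and `R` has a negative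
local minimum, impossible by `Δ R ≥ 0`, `dR = 0`, Hamilton's identity
`Δ R = g⁻¹(dR, df) + R − 2|Ric|²` (`dalembertian_scalarCurvature_of_soliton`) and `R² ≤ n|Ric|²`
(`scalarCurvature_nonneg_of_isLocalMin`). Otherwise the datum at `x_m` gives the frame `e_o`; each
`h_o(s) = ψ(β_o(s)/A) R(exp_{x_m}(s e_o))`, `β_o = d(p,x_m) + [o = none] s + q_o s²`, is `≥ u ∘ exp ≥ u(x_m) = h_o(0)`
near `0` (`ψ` antitone, `R < 0`), so `h_o'(0) = 0`, `h_o''(0) ≥ 0` (`first_second_order_along`,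
the second derivative of `R` along the geodesic being `Hess R(e_o, e_o)`); summing over the frame
(`Σ Hess R(e_o,e_o) = Δ R`, `g⁻¹(dR, df) = Σ dR(e_o) df(e_o)`) and inserting Hamilton's identity
gives `A · 2ψ|R|(x_m) ≤ n K (3 + C⁺)` (`cutoff_algebra`), while `ψ|R|(x_m) = |u(x_m)| ≥ |R(p)|`:
absurd for `A` large. Everything here is proved; no definition and no named fact is introduced.
First used by stub X_B of the crux `EntropyRung.NoncompactShrinkerGap` (SmoothPoincare4).

## References

* Z.-H. Zhang, *On the completeness of gradient Ricci solitons*, Proc. AMS 137 (2009) 2755–2759,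
  Thm. 1.3 (ii) and its proof, Step 1. [Zhang2009]
* B.-L. Chen, *Strong uniqueness of the Ricci flow*, J. Differential Geom. 82 (2009) 363–382,
  Cor. 2.5. [Chen2009]
* M. Eminenti, G. La Nave, C. Mantegazza, *Ricci solitons: the equation point of view*,
  manuscripta math. 127 (2008) 345–367, §3. [EminentiLanaveMantegazza2008]
-/

noncomputable section

open scoped Manifold ContDiff Topology NNReal ENNReal
open Set Filter Module
open Literature.Geometry.Lorentzian Literature.Geometry.Lorentzian.PseudoRiemannianMetric

namespace Literature.Geometry.Riemannian.Zhang2009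

section General

variable {E : Type*} [NormedAddCommGroup E] [NormedSpace ℝ E] [FiniteDimensional ℝ E]
  [CompleteSpace E] {M : Type*} [TopologicalSpace M] [ChartedSpace E M] [IsManifold 𝓘(ℝ, E) ∞ M]
  [T2Space M]
  (g : PseudoRiemannianMetric 𝓘(ℝ, E) ∞ E (TangentSpace 𝓘(ℝ, E) : M → Type _)) [g.HasLeviCivita]
  [CovariantDerivative.ContMDiffCovariantDerivative g.leviCivita 1]

omit [CompleteSpace E] [T2Space M] [g.HasLeviCivita]
  [CovariantDerivative.ContMDiffCovariantDerivative g.leviCivita 1] in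
/-- **Metric trace in an orthonormal frame**: for a `g_x`-orthonormal family `e` with
`card ι = dim M`, `tr_g T = Σ_o T(e_o, e_o)` (`tr_g T = tr (♯ ∘ T)` and `g(♯α, w) = α w`). In
particular `Δ_g F (x) = Σ_o Hess F (e_o, e_o)`. [folklore] -/
theorem trace_eq_sum_of_orthonormal {ι : Type*} [Fintype ι] [DecidableEq ι] (x : M)
    {e : ι → TangentSpace 𝓘(ℝ, E) x} (hon : ∀ i j, g.val x (e i) (e j) = if i = j then 1 else 0)
    (hcard : Fintype.card ι = finrank ℝ E) (T : LinearMap.BilinForm ℝ (TangentSpace 𝓘(ℝ, E) x)) :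
    g.trace x T = ∑ i, T (e i) (e i) := by
  have h := trace_eq_sum_bilin_of_orthonormal (V := E) (g.val x) hon hcard
    ((g.sharp x).toLinearMap ∘ₗ T)
  have h2 : g.trace x T = LinearMap.trace ℝ E ((g.sharp x).toLinearMap ∘ₗ T) := rfl
  rw [h2, h]
  refine Finset.sum_congr rfl fun i _ ↦ ?_
  exact g.val_sharp_apply x (T (e i)) (e i)

omit [CompleteSpace E] [T2Space M] [g.HasLeviCivita]
  [CovariantDerivative.ContMDiffCovariantDerivative g.leviCivita 1] in
/-- **Inverse metric in an orthonormal frame**: `g⁻¹(α, β) = Σ_o α(e_o) β(e_o)` for a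
`g_x`-orthonormal family `e` with `card ι = dim M` (`♯β = Σ_o β(e_o) e_o`). [folklore] -/
theorem innerDual_eq_sum_of_orthonormal {ι : Type*} [Fintype ι] [DecidableEq ι] (x : M)
    {e : ι → TangentSpace 𝓘(ℝ, E) x} (hon : ∀ i j, g.val x (e i) (e j) = if i = j then 1 else 0)
    (hcard : Fintype.card ι = finrank ℝ E) (α β : Module.Dual ℝ (TangentSpace 𝓘(ℝ, E) x)) :
    g.innerDual x α β = ∑ i, α (e i) * β (e i) := by
  have hexp : g.sharp x β = ∑ i, β (e i) • e i := by
    refine (eq_sum_bilin_smul_of_orthonormal (V := E) (g.val x) hon hcard (g.sharp x β)).trans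
      (Finset.sum_congr rfl fun i _ ↦ ?_)
    exact congrArg (· • e i) (g.val_sharp_apply x β (e i))
  show α (g.sharp x β) = _
  rw [hexp, map_sum]
  refine Finset.sum_congr rfl fun i _ ↦ ?_
  rw [map_smul, smul_eq_mul, mul_comm]

omit [T2Space M] [CovariantDerivative.ContMDiffCovariantDerivative g.leviCivita 1] in
/-- **A shrinking gradient soliton has `R ≥ 0` at every local minimum of `R`** (the compact-case
argument of Eminenti–La Nave–Mantegazza 2008, §3, localised): at a local minimum `x₀` of `R`,
`Δ R ≥ 0` (`dalembertian_nonneg_of_isLocalMin`) and `dR = 0` (Fermat in the chart), so Hamilton's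
identity `Δ R = g⁻¹(dR, df) + R − 2|Ric|²` gives `2|Ric|² ≤ R`, and `R² ≤ n |Ric|²` forces
`R(x₀) ≥ 0`. [cite: EminentiLanaveMantegazza2008, §3 (discussion before Prop. 3.4)] -/
theorem scalarCurvature_nonneg_of_isLocalMin (hg : g.IsRiemannian) {f : M → ℝ}
    (hf : ContMDiff 𝓘(ℝ, E) 𝓘(ℝ, ℝ) ∞ f)
    (hsol : ∀ (x : M) (X Y : TangentSpace 𝓘(ℝ, E) x),
      g.ricci x X Y + g.hessian f x X Y = (1 / 2 : ℝ) * g.val x X Y)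
    {x₀ : M} (hmin : IsLocalMin g.scalarCurvature x₀) : 0 ≤ g.scalarCurvature x₀ := by
  have hS : ContMDiff 𝓘(ℝ, E) 𝓘(ℝ, ℝ) ∞ g.scalarCurvature := contMDiff_scalarCurvature g
  have hS2 : ContMDiffAt 𝓘(ℝ, E) 𝓘(ℝ, ℝ) 2 g.scalarCurvature x₀ :=
    (hS.of_le (WithTop.coe_le_coe.mpr le_top)).contMDiffAt
  have hlap : 0 ≤ g.dalembertian g.scalarCurvature x₀ :=
    g.dalembertian_nonneg_of_isLocalMin hS2 hmin (hg x₀)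
  have hmf : mfderiv 𝓘(ℝ, E) 𝓘(ℝ, ℝ) g.scalarCurvature x₀ = 0 :=
    Literature.Topology.FourManifolds.IsLocalMin.isMCriticalPt (I := 𝓘(ℝ, E)) hmin
  have hd : mvfderiv 𝓘(ℝ, E) g.scalarCurvature x₀ = 0 := by
    ext v
    simp [mvfderiv, hmf]
  have key := dalembertian_scalarCurvature_of_soliton g hf hsol x₀
  rw [hd] at key
  have hinner : g.innerDual x₀ ((0 : TangentSpace 𝓘(ℝ, E) x₀ →L[ℝ] ℝ) :
      TangentSpace 𝓘(ℝ, E) x₀ →ₗ[ℝ] ℝ) (mvfderiv 𝓘(ℝ, E) f x₀ : TangentSpace 𝓘(ℝ, E) x₀ →ₗ[ℝ] ℝ)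
      = 0 := by
    simp [PseudoRiemannianMetric.innerDual]
  rw [hinner, zero_add] at key
  have hRic : g.normSq x₀ (g.ricci x₀) ≤ (1 / 2 : ℝ) * g.scalarCurvature x₀ := by linarith
  have hCS : g.scalarCurvature x₀ ^ 2 ≤ finrank ℝ E * g.normSq x₀ (g.ricci x₀) :=
    g.trace_sq_le_finrank_mul_normSq x₀ hg (g.ricci x₀)
  have hn : (0 : ℝ) ≤ finrank ℝ E := Nat.cast_nonneg _
  by_contra hneg
  have hneg : g.scalarCurvature x₀ < 0 := lt_of_not_ge hneg
  have h1 : (finrank ℝ E : ℝ) * g.normSq x₀ (g.ricci x₀) ≤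
      finrank ℝ E * ((1 / 2 : ℝ) * g.scalarCurvature x₀) := mul_le_mul_of_nonneg_left hRic hn
  have h2 : (finrank ℝ E : ℝ) * ((1 / 2 : ℝ) * g.scalarCurvature x₀) ≤ 0 :=
    mul_nonpos_of_nonneg_of_nonpos hn (by linarith)
  nlinarith

omit [T2Space M] [CovariantDerivative.ContMDiffCovariantDerivative g.leviCivita 1] in
/-- **First- and second-order conditions along a geodesic direction** (Zhang 2009, proof of
Thm. 1.3, Step 1, the computation at the minimum point). Let `c` be a geodesic with `c(0) = x`,
`c'(0) = v`, and suppose `h(s) = ψ((T + a s + q s²)/A) · R(c(s))` has a local minimum at `s = 0`.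
Since `(R ∘ c)' = dR(c')` (`hasDerivAt_comp_curve_mvfderiv`) and `(dR(c'))'(0) = Hess R(v, v)`
(`hasDerivAt_mvfderiv_velocity_of_isGeodesicOn`), the conditions `h'(0) = 0`, `h''(0) ≥ 0` read
`ψ'(T/A)(a/A) R(x) + ψ(T/A) dR(v) = 0` and
`(ψ''(T/A)(a/A)² + ψ'(T/A)(2q/A)) R(x) + 2ψ'(T/A)(a/A) dR(v) + ψ(T/A) Hess R(v,v) ≥ 0`.
[cite: Zhang2009, proof of Thm. 1.3, Step 1] -/
theorem first_second_order_along {x : M} {v : TangentSpace 𝓘(ℝ, E) x} {c : ℝ → M}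
    (hgeo : IsGeodesic g.leviCivita c) (hc0 : c 0 = x) (hv : velocity 𝓘(ℝ, E) c 0 = v)
    {ψ ψ' ψ'' : ℝ → ℝ} (hψ : ∀ t, HasDerivAt ψ (ψ' t) t) (hψ' : ∀ t, HasDerivAt ψ' (ψ'' t) t)
    (T a q A : ℝ)
    (hmin : IsLocalMin (fun s ↦ ψ ((T + a * s + q * s ^ 2) / A) * g.scalarCurvature (c s)) 0) :
    ψ' (T / A) * (a / A) * g.scalarCurvature x
        + ψ (T / A) * mvfderiv 𝓘(ℝ, E) g.scalarCurvature x v = 0 ∧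
      0 ≤ (ψ'' (T / A) * (a / A) ^ 2 + ψ' (T / A) * (2 * q / A)) * g.scalarCurvature x
        + 2 * ψ' (T / A) * (a / A) * mvfderiv 𝓘(ℝ, E) g.scalarCurvature x v
        + ψ (T / A) * g.hessian g.scalarCurvature x v v := by
  subst hc0
  subst hv
  have hR : ContMDiff 𝓘(ℝ, E) 𝓘(ℝ, ℝ) ∞ g.scalarCurvature := contMDiff_scalarCurvature g
  have hF : ∀ s, HasDerivAt (fun s ↦ g.scalarCurvature (c s))
      (mvfderiv 𝓘(ℝ, E) g.scalarCurvature (c s) (velocity 𝓘(ℝ, E) c s)) s := fun s ↦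
    hasDerivAt_comp_curve_mvfderiv (hR.mdifferentiableAt (by simp))
      (IsGeodesicOn.mdifferentiableAt_holds hgeo (mem_univ s))
  have hR2 : ContMDiffAt 𝓘(ℝ, E) 𝓘(ℝ, ℝ) 2 g.scalarCurvature (c 0) :=
    (hR.of_le (WithTop.coe_le_coe.mpr le_top)).contMDiffAt
  have hF₁ : HasDerivAt (fun s ↦ mvfderiv 𝓘(ℝ, E) g.scalarCurvature (c s) (velocity 𝓘(ℝ, E) c s))
      (g.hessian g.scalarCurvature (c 0) (velocity 𝓘(ℝ, E) c 0) (velocity 𝓘(ℝ, E) c 0)) 0 :=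
    g.hasDerivAt_mvfderiv_velocity_of_isGeodesicOn hgeo (mem_univ 0) hR2
  obtain ⟨hd, hd2⟩ := hasDerivAt_cutoff_mul T a q A hψ hψ' hF hF₁
  obtain ⟨h1, h2⟩ := deriv_eq_zero_and_nonneg_of_isLocalMin hmin (Eventually.of_forall hd) hd2
  have e1 : (T + a * 0 + q * 0 ^ 2) / A = T / A := by ring
  have e2 : (a + 2 * q * 0) / A = a / A := by ring
  rw [e1, e2] at h1
  exact ⟨h1, h2⟩

/-- **Zhang's localised minimum principle** (Z.-H. Zhang 2009, proof of Thm. 1.3, Step 1; B.-L.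
Chen 2009, Cor. 2.5), with the Laplacian comparison for the distance entering as an upper-barrier
DATUM along geodesic directions: on a connected Riemannian manifold with compact closed distance
balls carrying `f` with `Ric + Hess f = g/2`, if for every `p` there is `C` such that at every
`x₀` with `d(p, x₀) ≥ 1` some `g`-orthonormal frame `e : Option (Fin k) → T_{x₀}M`
(`k + 1 = dim M`) and reals `q_o` satisfy `d(p, exp_{x₀}(s e_o)) ≤ d(p, x₀) + [o = none] s + q_o s²`
for `s` near `0` and `2 Σ_o q_o − df(e none) ≤ C`, then `R ≥ 0` everywhere. See the module
docstring for the proof. [cite: Zhang2009, Thm. 1.3 (ii), proof Step 1] -/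
theorem minimumPrinciple_core [RegularSpace M] [ConnectedSpace M]
    (hg : g.IsRiemannian) (hcpt : ∀ (x : M) (r : ℝ≥0), IsCompact {y : M | g.edist hg x y ≤ r})
    {f : M → ℝ} (hf : ContMDiff 𝓘(ℝ, E) 𝓘(ℝ, ℝ) ∞ f)
    (hsol : ∀ (x : M) (X Y : TangentSpace 𝓘(ℝ, E) x),
      g.ricci x X Y + g.hessian f x X Y = (1 / 2 : ℝ) * g.val x X Y)
    (hcmp : ∀ p : M, ∃ C : ℝ, ∀ x₀ : M, 1 ≤ (g.edist hg p x₀).toReal →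
      ∃ (k : ℕ) (e : Option (Fin k) → TangentSpace 𝓘(ℝ, E) x₀) (q : Option (Fin k) → ℝ),
        Fintype.card (Option (Fin k)) = finrank ℝ E ∧
        (∀ o o', g.val x₀ (e o) (e o') = if o = o' then 1 else 0) ∧
        2 * (∑ o, q o) - mvfderiv 𝓘(ℝ, E) f x₀ (e none) ≤ C ∧
        ∀ o, ∀ᶠ s in 𝓝 (0 : ℝ), (g.edist hg p (expMap g.leviCivita x₀ (s • e o))).toReal ≤
          (g.edist hg p x₀).toReal + (if o = none then s else 0) + q o * s ^ 2)
    (x : M) : 0 ≤ g.scalarCurvature x := by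
  classical
  have hRs : ContMDiff 𝓘(ℝ, E) 𝓘(ℝ, ℝ) ∞ g.scalarCurvature := contMDiff_scalarCurvature g
  have hc : IsGeodesicallyComplete g.leviCivita :=
    (isGeodesicallyComplete_iff_isCompact_setOf_edist_le g le_rfl hg).2 hcpt
  by_contra hneg
  have hneg : g.scalarCurvature x < 0 := lt_of_not_ge hneg
  obtain ⟨C, hC⟩ := hcmp x
  obtain ⟨ψ, ψ', ψ'', K, hψd, hψ'd, hanti, hone, hzero, hψ0, hψ'le, hK0, hK1, hK2, hK3⟩ :=
    exists_cutoffSq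
  -- the radius `A`
  set d : ℝ := (finrank ℝ E : ℝ) with hd
  have hd0 : 0 ≤ d := Nat.cast_nonneg _
  obtain ⟨A, hA2, hAbig⟩ : ∃ A : ℝ, 2 ≤ A ∧
      d * K * (3 + max C 0) < A * (2 * -g.scalarCurvature x) := by
    refine ⟨max 2 (d * K * (3 + max C 0) / (2 * -g.scalarCurvature x) + 1), le_max_left _ _, ?_⟩
    have hpos : 0 < 2 * -g.scalarCurvature x := by linarith
    have h1 : d * K * (3 + max C 0) / (2 * -g.scalarCurvature x) + 1 ≤
        max 2 (d * K * (3 + max C 0) / (2 * -g.scalarCurvature x) + 1) := le_max_right _ _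
    have h2 : d * K * (3 + max C 0) / (2 * -g.scalarCurvature x) * (2 * -g.scalarCurvature x)
        = d * K * (3 + max C 0) := div_mul_cancel₀ _ hpos.ne'
    nlinarith
  have hA0 : 0 < A := by linarith
  -- the distance from `x` and the localised function
  obtain ⟨ρ, hρ⟩ : ∃ ρ : M → ℝ, ∀ y, ρ y = (g.edist hg x y).toReal := ⟨_, fun _ ↦ rfl⟩
  have hρc : Continuous ρ := by
    have h1 : Continuous fun y ↦ g.edist hg x y :=
      (PseudoRiemannianMetric.continuous_edist hg).comp (Continuous.prodMk_right x)
    have h2 : ρ = fun y ↦ (g.edist hg x y).toReal := funext hρ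
    rw [h2]
    exact continuous_iff_continuousAt.2 fun y ↦
      (ENNReal.continuousAt_toReal (edist_ne_top hg x y)).comp h1.continuousAt
  have hρ0 : ρ x = 0 := by rw [hρ, PseudoRiemannianMetric.edist_self, ENNReal.toReal_zero]
  have hρnn : ∀ y, 0 ≤ ρ y := fun y ↦ by rw [hρ]; exact ENNReal.toReal_nonneg
  have hψc : Continuous ψ := continuous_iff_continuousAt.2 fun t ↦ (hψd t).continuousAt
  obtain ⟨u, hu⟩ : ∃ u : M → ℝ, ∀ y, u y = ψ (ρ y / A) * g.scalarCurvature y :=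
    ⟨_, fun _ ↦ rfl⟩
  have huc : Continuous u := by
    rw [show u = fun y ↦ ψ (ρ y / A) * g.scalarCurvature y from funext hu]
    exact (hψc.comp (hρc.div_const A)).mul hRs.continuous
  -- the compact ball and the minimum
  have hmem : ∀ y, y ∈ {y : M | g.edist hg x y ≤ ((A.toNNReal : ℝ≥0) : ℝ≥0∞)} ↔ ρ y ≤ A := by
    intro y
    rw [mem_setOf_eq, hρ]
    exact ENNReal.le_ofReal_iff_toReal_le (edist_ne_top hg x y) hA0.le
  have hxmem : x ∈ {y : M | g.edist hg x y ≤ ((A.toNNReal : ℝ≥0) : ℝ≥0∞)} :=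
    (hmem x).2 (by rw [hρ0]; exact hA0.le)
  obtain ⟨xm, hxm, hmin⟩ :=
    (hcpt x A.toNNReal).exists_isMinOn ⟨x, hxmem⟩ huc.continuousOn
  have hux : u x = g.scalarCurvature x := by
    rw [hu, hρ0, zero_div, hone 0 (by norm_num), one_mul]
  have hm_le : u xm ≤ g.scalarCurvature x := hux ▸ hmin hxmem
  have hm_neg : u xm < 0 := by linarith
  have hglob : ∀ y, u xm ≤ u y := by
    intro y
    by_cases hy : y ∈ {y : M | g.edist hg x y ≤ ((A.toNNReal : ℝ≥0) : ℝ≥0∞)}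
    · exact hmin hy
    · have hy' : A < ρ y := lt_of_not_ge fun h ↦ hy ((hmem y).2 h)
      have h0 : u y = 0 := by
        rw [hu, hzero _ ((one_le_div hA0).2 hy'.le), zero_mul]
      linarith
  -- signs at the minimum point
  have hT0 : 0 ≤ ρ xm := hρnn xm
  have hΨpos : 0 < ψ (ρ xm / A) := by
    rcases (hψ0 (ρ xm / A)).lt_or_eq with h | h
    · exact h
    · have : u xm = 0 := by rw [hu, ← h, zero_mul]
      linarith
  have hRm : g.scalarCurvature xm < 0 := by
    by_contra h
    have : 0 ≤ u xm := by rw [hu]; exact mul_nonneg (hψ0 _) (not_lt.1 h)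
    linarith
  have hTA : ρ xm < A := by
    by_contra h
    have : ψ (ρ xm / A) = 0 := hzero _ ((one_le_div hA0).2 (not_lt.1 h))
    linarith
  have hTA1 : ρ xm / A ∈ Icc (0 : ℝ) 1 :=
    ⟨div_nonneg hT0 hA0.le, by rw [div_le_one hA0]; exact hTA.le⟩
  have huxm : u xm = ψ (ρ xm / A) * g.scalarCurvature xm := hu xm
  rcases lt_or_ge (ρ xm) 1 with hT1 | hT1
  · -- `R` itself has a negative local minimum at `xm`
    have hloc : IsLocalMin g.scalarCurvature xm := by
      have hev : ∀ᶠ y in 𝓝 xm, ρ y < 1 := (isOpen_lt hρc continuous_const).mem_nhds hT1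
      filter_upwards [hev] with y hy
      have hψy : ψ (ρ y / A) = 1 := hone _ (by rw [div_le_iff₀ hA0]; linarith)
      have hψm : ψ (ρ xm / A) = 1 := hone _ (by rw [div_le_iff₀ hA0]; linarith)
      have h1 : u y = g.scalarCurvature y := by rw [hu, hψy, one_mul]
      rw [hψm, one_mul] at huxm
      linarith [hglob y]
    linarith [scalarCurvature_nonneg_of_isLocalMin g hg hf hsol hloc]
  · -- the datum at `xm`
    obtain ⟨k, e, q, hcard, hon, hCq, hbar⟩ := hC xm (by rw [← hρ]; exact hT1)
    have hdir : ∀ o, (ψ' (ρ xm / A) * ((if o = none then (1 : ℝ) else 0) / A)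
          * g.scalarCurvature xm
        + ψ (ρ xm / A) * mvfderiv 𝓘(ℝ, E) g.scalarCurvature xm (e o) = 0) ∧
        0 ≤ (ψ'' (ρ xm / A) * ((if o = none then (1 : ℝ) else 0) / A) ^ 2
            + ψ' (ρ xm / A) * (2 * q o / A)) * g.scalarCurvature xm
          + 2 * ψ' (ρ xm / A) * ((if o = none then (1 : ℝ) else 0) / A)
            * mvfderiv 𝓘(ℝ, E) g.scalarCurvature xm (e o)
          + ψ (ρ xm / A) * g.hessian g.scalarCurvature xm (e o) (e o) := by
      intro o
      have hgeo : IsGeodesic g.leviCivita (fun s : ℝ ↦ expMap g.leviCivita xm (s • e o)) :=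
        isGeodesic_expMap_smul_of_isGeodesicallyComplete hc xm (e o)
      have hcc0 : (fun s : ℝ ↦ expMap g.leviCivita xm (s • e o)) 0 = xm := by
        simp only [zero_smul]
        exact expMap_zero (cov := g.leviCivita) xm
      have hv0 : velocity 𝓘(ℝ, E) (fun s : ℝ ↦ expMap g.leviCivita xm (s • e o)) 0 = e o :=
        velocity_expMap_smul_zero (cov := g.leviCivita) xm (e o)
      refine first_second_order_along g hgeo hcc0 hv0 hψd hψ'd (ρ xm)
        (if o = none then (1 : ℝ) else 0) (q o) A ?_
      -- the test function has a local minimum at `0`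
      have hcont : ContinuousAt (fun s : ℝ ↦ g.scalarCurvature (expMap g.leviCivita xm (s • e o)))
          0 :=
        hRs.continuous.continuousAt.comp
          (IsGeodesicOn.mdifferentiableAt_holds hgeo (mem_univ 0)).continuousAt
      have hev1 : ∀ᶠ s in 𝓝 (0 : ℝ), g.scalarCurvature (expMap g.leviCivita xm (s • e o)) < 0 :=
        hcont.eventually_lt continuousAt_const
          (by rw [zero_smul, expMap_zero (cov := g.leviCivita) xm]; exact hRm)
      filter_upwards [hev1, hbar o] with s hs1 hs2
      have hite : (if o = none then (1 : ℝ) else 0) * s = if o = none then s else 0 := by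
        split_ifs <;> simp
      have hβ : ρ (expMap g.leviCivita xm (s • e o)) ≤
          ρ xm + (if o = none then (1 : ℝ) else 0) * s + q o * s ^ 2 := by
        rw [hρ, hρ, hite]
        exact hs2
      have hψle : ψ ((ρ xm + (if o = none then (1 : ℝ) else 0) * s + q o * s ^ 2) / A) ≤
          ψ (ρ (expMap g.leviCivita xm (s • e o)) / A) :=
        hanti (div_le_div_of_nonneg_right hβ hA0.le)
      have h3 := mul_le_mul_of_nonpos_right hψle hs1.le
      rw [← hu] at h3
      have h4 := hglob (expMap g.leviCivita xm (s • e o))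
      have h5 : ψ ((ρ xm + (if o = none then (1 : ℝ) else 0) * 0 + q o * 0 ^ 2) / A) *
          g.scalarCurvature (expMap g.leviCivita xm ((0 : ℝ) • e o)) = u xm := by
        rw [huxm, mul_zero, add_zero, zero_pow two_ne_zero, mul_zero, add_zero, zero_smul,
          expMap_zero (cov := g.leviCivita) xm]
      show ψ ((ρ xm + (if o = none then (1 : ℝ) else 0) * 0 + q o * 0 ^ 2) / A) *
          g.scalarCurvature (expMap g.leviCivita xm ((0 : ℝ) • e o)) ≤
        ψ ((ρ xm + (if o = none then (1 : ℝ) else 0) * s + q o * s ^ 2) / A) *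
          g.scalarCurvature (expMap g.leviCivita xm (s • e o))
      rw [h5]
      exact h4.trans h3
    -- traces in the frame and Hamilton's identity
    have htr : g.dalembertian g.scalarCurvature xm =
        ∑ o, g.hessian g.scalarCurvature xm (e o) (e o) :=
      trace_eq_sum_of_orthonormal g xm hon hcard _
    have hinner : g.innerDual xm
        (mvfderiv 𝓘(ℝ, E) g.scalarCurvature xm : TangentSpace 𝓘(ℝ, E) xm →ₗ[ℝ] ℝ)
        (mvfderiv 𝓘(ℝ, E) f xm : TangentSpace 𝓘(ℝ, E) xm →ₗ[ℝ] ℝ) =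
        ∑ o, mvfderiv 𝓘(ℝ, E) g.scalarCurvature xm (e o) * mvfderiv 𝓘(ℝ, E) f xm (e o) :=
      innerDual_eq_sum_of_orthonormal g xm hon hcard _ _
    have hHam := dalembertian_scalarCurvature_of_soliton g hf hsol xm
    rw [htr, hinner] at hHam
    have hHam' : ∑ o, g.hessian g.scalarCurvature xm (e o) (e o) =
        ∑ o, mvfderiv 𝓘(ℝ, E) g.scalarCurvature xm (e o) * mvfderiv 𝓘(ℝ, E) f xm (e o)
          + g.scalarCurvature xm - 2 * g.normSq xm (g.ricci xm) := by
      rw [hHam]; ring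
    have hCS : g.scalarCurvature xm ^ 2 ≤ d * g.normSq xm (g.ricci xm) :=
      g.trace_sq_le_finrank_mul_normSq xm hg (g.ricci xm)
    have key := cutoff_algebra (a := fun o : Option (Fin k) ↦ if o = none then (1 : ℝ) else 0)
      none (if_pos rfl) (fun o ho ↦ if_neg ho) hΨpos (hψ'le _) (hK1 _ hTA1) (hK2 _ hTA1)
      (hK3 _ hTA1) (by linarith) hRm (fun o ↦ (hdir o).1) (fun o ↦ (hdir o).2) hHam' hCS hd0 hCq
    -- `ψ |R|(xm) = |u(xm)| ≥ |R(x)|`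
    have h6 : -g.scalarCurvature x ≤ ψ (ρ xm / A) * -g.scalarCurvature xm := by
      rw [huxm] at hm_le; linarith
    have h7 : A * (2 * -g.scalarCurvature x) ≤ A * (2 * ψ (ρ xm / A) * -g.scalarCurvature xm) :=
      mul_le_mul_of_nonneg_left (by linarith) hA0.le
    linarith

end General

end Literature.Geometry.Riemannian.Zhang2009

end
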